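import Mathlib
import HarnessLib
import Summits.Ventures.HSemireg.GridBarrierNormKernel

/-!
# Venture HSemireg — THEOREM GRID, step (ii) ⇒ (iii): the grid law forces a SPLIT Weil datum (norm-group arithmetic)

HONEST FRAMING. Lean leaf for the computation cell `pub-hsemireg` (target seat t-5 gen 10; file of record
`run/shared/lean/pub/pub-hsemireg/target-g6/GRID-BARRIER-t5g9.md`, §0 and §5, 2026-08-23). THEOREM GRID there
says that a box-product / secant-type object `Φ(F₁ ⊠ F₂)` on a Weil-type abelian `2n`-fold with CM field
`K = ℚ(ω)` (or `ℚ(i)`) and diagonal polarisation weights `c` can carry a class-exact Weil-alive twisted Chern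
character `v = r e^{t h} + r̄ e^{t̄ h} + λ w + λ̄ w̄` only if the GRID LAW
`N(λ) = N(r) · ∏ c_a · |t − t̄|^{2n}` holds (step (ii), proved there by exterior-algebra / catalecticant
computations which are NOT formalised here), and concludes (step (iii)) that `∏ c_a` is a norm from `K`, i.e.
that the Weil datum is SPLIT in the sense of [Deligne1982HodgeCycles, §4 Cor. 4.2] /
[vanGeemen1994HodgeAV, Lemma 5.2]. THIS FILE proves — fully, no hypotheses — only the ARITHMETIC of step
(ii) ⇒ (iii), uniformly in `n`: the rational values of the norm form of `K` are a group under multiplication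
(Brahmagupta's identity), `|t − t̄|^{2n} = (3β²)^n` (resp. `(4β²)^n`) is itself a norm value, hence the law
forces `∏ c_a ∈ N(K^*)`; and, using the kernel file `GridBarrierNormKernel.lean` (`2` is inert in `ℤ[ω]`),
that on the cell's deciding data `(1,1,1,2)` (n = 2) and `R1 = (1,1,1,1,1,2)` (n = 3) — where `∏ c_a = 2` —
the law has NO solution for any `n`. A Gaussian twin (`3` inert in `ℤ[i]`) is included. No object is
constructed, no semiregularity map is computed, and nothing here bears on HC, HC_CM or HC_AV; the geometric
steps of THEOREM GRID (symbol calculus, two-node classification, corner reality) remain pencil + machine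
checks in the cell's note and are not claimed here.

Dictionary with the note: `λ = a + bω`, `N(λ) = a² − ab + b²`; `r = u + vω ≠ 0`; `t = α + βω ∉ ℚ`, so
`t − t̄ = β(ω − ω̄) = β√−3` and `|t − t̄|² = 3β²`; `P = ∏ c_a` (diagonal frame) or `P = q_W · d_h`
(invariant form, §5 of the note). For `K = ℚ(i)`: `N(a + bi) = a² + b²`, `|t − t̄|² = 4β²`.
-/

namespace Summit.Ventures.HSemireg

/-! ## Values of a binary norm form `x² + D·y²` over `ℚ`: a multiplicative group -/

/-! Convention (no new definitions in this file): «`m` is represented by `x² + D·y²`» is always written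
out as `∃ x y : ℚ, x ^ 2 + D * y ^ 2 = m` (for `D = 3` these are exactly the norms from
`ℚ(ω) = ℚ(√−3)`, for `D = 1` the norms from `ℚ(i)`); «Eisenstein norm» as
`∃ a b : ℚ, a ^ 2 - a * b + b ^ 2 = m`; «Gaussian norm» as `∃ a b : ℚ, a ^ 2 + b ^ 2 = m`. -/

section BinNorm

/-- `1 = 1² + D·0²` is represented. [folklore] -/
theorem binNorm_one (D : ℚ) : ∃ x y : ℚ, x ^ 2 + D * y ^ 2 = 1 := ⟨1, 0, by ring⟩

/-- Every rational square `q² = q² + D·0²` is represented. [folklore] -/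
theorem binNorm_sq (D q : ℚ) : ∃ x y : ℚ, x ^ 2 + D * y ^ 2 = q ^ 2 := ⟨q, 0, by ring⟩

/-- `D·q² = 0² + D·q²` is represented (for `D = 3`: `3β² = |β√−3|²` is a norm from `ℚ(ω)`). [folklore] -/
theorem binNorm_base_mul_sq (D q : ℚ) : ∃ x y : ℚ, x ^ 2 + D * y ^ 2 = D * q ^ 2 := ⟨0, q, by ring⟩

/-- Brahmagupta's identity: represented values are closed under multiplication
(`(x² + Dy²)(x'² + Dy'²) = (xx' − Dyy')² + D(xy' + x'y)²`). [folklore] -/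
theorem binNorm_mul {D m m' : ℚ} (h : ∃ x y : ℚ, x ^ 2 + D * y ^ 2 = m)
    (h' : ∃ x y : ℚ, x ^ 2 + D * y ^ 2 = m') : ∃ x y : ℚ, x ^ 2 + D * y ^ 2 = m * m' := by
  obtain ⟨x, y, rfl⟩ := h
  obtain ⟨x', y', rfl⟩ := h'
  exact ⟨x * x' - D * y * y', x * y' + x' * y, by ring⟩

/-- Represented values are closed under natural powers. [folklore] -/
theorem binNorm_pow {D m : ℚ} (h : ∃ x y : ℚ, x ^ 2 + D * y ^ 2 = m) (n : ℕ) :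
    ∃ x y : ℚ, x ^ 2 + D * y ^ 2 = m ^ n := by
  induction n with
  | zero => simpa using binNorm_one D
  | succ n ih => simpa [pow_succ] using binNorm_mul ih h

/-- A non-zero represented value has a represented inverse (`(x/m)² + D(y/m)² = 1/m`). [folklore] -/
theorem binNorm_inv {D m : ℚ} (h : ∃ x y : ℚ, x ^ 2 + D * y ^ 2 = m) (hm : m ≠ 0) :
    ∃ x y : ℚ, x ^ 2 + D * y ^ 2 = m⁻¹ := by
  obtain ⟨x, y, hxy⟩ := h
  refine ⟨x / m, y / m, ?_⟩
  have : (x / m) ^ 2 + D * (y / m) ^ 2 = (x ^ 2 + D * y ^ 2) / m ^ 2 := by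
    field_simp
  rw [this, hxy, pow_two, ← div_div, div_self hm, one_div]

/-- The division step of THEOREM GRID (ii) ⇒ (iii): if `Nl = Nr · P · s` with `Nl`, `Nr`, `s` represented
and `Nr ≠ 0`, `s ≠ 0`, then `P = Nl · Nr⁻¹ · s⁻¹` is represented. [folklore] -/
theorem binNorm_of_law {D Nl Nr P s : ℚ} (hl : ∃ x y : ℚ, x ^ 2 + D * y ^ 2 = Nl)
    (hr : ∃ x y : ℚ, x ^ 2 + D * y ^ 2 = Nr) (hs : ∃ x y : ℚ, x ^ 2 + D * y ^ 2 = s)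
    (hr0 : Nr ≠ 0) (hs0 : s ≠ 0) (hlaw : Nl = Nr * P * s) : ∃ x y : ℚ, x ^ 2 + D * y ^ 2 = P := by
  have hP : P = Nl * Nr⁻¹ * s⁻¹ := by
    rw [hlaw]; field_simp
  rw [hP]
  exact binNorm_mul (binNorm_mul hl (binNorm_inv hr hr0)) (binNorm_inv hs hs0)

end BinNorm

/-! ## The Eisenstein case `K = ℚ(ω)`, `N(a + bω) = a² − ab + b²` -/

/-- `a² − ab + b² = (a − b/2)² + 3(b/2)²`: the Eisenstein norms are exactly the values of `x² + 3y²`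
over `ℚ`. [folklore] -/
theorem eisensteinNorm_iff_binNorm_three (m : ℚ) :
    (∃ a b : ℚ, a ^ 2 - a * b + b ^ 2 = m) ↔ ∃ x y : ℚ, x ^ 2 + 3 * y ^ 2 = m := by
  constructor
  · rintro ⟨a, b, rfl⟩
    exact ⟨a - b / 2, b / 2, by ring⟩
  · rintro ⟨x, y, rfl⟩
    exact ⟨x + y, 2 * y, by ring⟩

/-- The Eisenstein norm form is positive definite: `u² − uv + v² = 0 ↔ u = v = 0`. [folklore] -/
theorem eisensteinNorm_eq_zero_iff (u v : ℚ) : u ^ 2 - u * v + v ^ 2 = 0 ↔ u = 0 ∧ v = 0 := by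
  constructor
  · intro h
    have hv2 : v ^ 2 = 0 := by nlinarith [sq_nonneg (2 * u - v), sq_nonneg v]
    have hv : v = 0 := pow_eq_zero_iff (two_ne_zero) |>.mp hv2
    subst hv
    have hu2 : u ^ 2 = 0 := by nlinarith [h]
    exact ⟨pow_eq_zero_iff (two_ne_zero) |>.mp hu2, rfl⟩
  · rintro ⟨rfl, rfl⟩; ring

/-- The Eisenstein norm form is non-negative: `0 ≤ u² − uv + v²`. [folklore] -/
theorem eisensteinNorm_nonneg (u v : ℚ) : 0 ≤ u ^ 2 - u * v + v ^ 2 := by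
  nlinarith [sq_nonneg (2 * u - v), sq_nonneg v]

/-- `2·m` is never an Eisenstein norm when `m ≠ 0` is one (`2` is inert in `ℤ[ω]`, kernel file):
covers `∏ c_a ∈ {2, 6, 8, 18, 24, …}`. [cite: IrelandRosen1990, Ch. 9 §1 Prop. 9.1.4] -/
theorem not_eisensteinNorm_two_mul {m : ℚ} (hm : ∃ a b : ℚ, a ^ 2 - a * b + b ^ 2 = m) (hm0 : m ≠ 0) :
    ¬ ∃ a b : ℚ, a ^ 2 - a * b + b ^ 2 = 2 * m := by
  intro h2m
  have h2 : ∃ x y : ℚ, x ^ 2 + 3 * y ^ 2 = 2 := by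
    have hm' := (eisensteinNorm_iff_binNorm_three _).mp hm
    have h2m' := (eisensteinNorm_iff_binNorm_three _).mp h2m
    have : (2 : ℚ) = 2 * m * m⁻¹ := by field_simp
    rw [this]
    exact binNorm_mul h2m' (binNorm_inv hm' hm0)
  obtain ⟨a, b, hab⟩ := (eisensteinNorm_iff_binNorm_three 2).mpr h2
  exact eisensteinNorm_ne_two a b hab

/-- In particular `2` itself is not an Eisenstein norm (restated from the kernel file in this vocabulary).
[cite: IrelandRosen1990, Ch. 9 §1 Prop. 9.1.4] -/
theorem not_eisensteinNorm_two : ¬ ∃ a b : ℚ, a ^ 2 - a * b + b ^ 2 = 2 := by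
  have := not_eisensteinNorm_two_mul (m := 1) ⟨1, 0, by ring⟩ one_ne_zero
  simpa using this

/-- **THEOREM GRID, (ii) ⇒ (iii), `K = ℚ(ω)`, every `n`.** If `λ = a + bω`, `r = u + vω ≠ 0`,
`t − t̄ = β√−3` with `β ≠ 0` (i.e. `t ∉ ℚ`), and the grid law `N(λ) = N(r) · P · |t − t̄|^{2n}` holds
(`P = ∏ c_a` in the diagonal frame, `P = q_W·d_h` in the invariant form), then `P` is a norm from `ℚ(ω)` —
the Weil datum is split ([Deligne1982HodgeCycles, §4 Cor. 4.2], [vanGeemen1994HodgeAV, Lemma 5.2]).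
Only the arithmetic is proved here; the law itself is the note's step (ii). [folklore] -/
theorem gridLaw_forces_eisensteinNorm (n : ℕ) {a b u v β P : ℚ} (hr : ¬ (u = 0 ∧ v = 0)) (hβ : β ≠ 0)
    (hlaw : a ^ 2 - a * b + b ^ 2 = (u ^ 2 - u * v + v ^ 2) * P * (3 * β ^ 2) ^ n) :
    ∃ x y : ℚ, x ^ 2 - x * y + y ^ 2 = P := by
  rw [eisensteinNorm_iff_binNorm_three]
  have hl : ∃ x y : ℚ, x ^ 2 + 3 * y ^ 2 = a ^ 2 - a * b + b ^ 2 :=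
    (eisensteinNorm_iff_binNorm_three _).mp ⟨a, b, rfl⟩
  have hrN : ∃ x y : ℚ, x ^ 2 + 3 * y ^ 2 = u ^ 2 - u * v + v ^ 2 :=
    (eisensteinNorm_iff_binNorm_three _).mp ⟨u, v, rfl⟩
  have hs : ∃ x y : ℚ, x ^ 2 + 3 * y ^ 2 = (3 * β ^ 2) ^ n := binNorm_pow (binNorm_base_mul_sq 3 β) n
  have hr0 : u ^ 2 - u * v + v ^ 2 ≠ 0 := fun h => hr ((eisensteinNorm_eq_zero_iff u v).mp h)
  have hs0 : (3 * β ^ 2) ^ n ≠ 0 := pow_ne_zero _ (by positivity)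
  exact binNorm_of_law hl hrN hs hr0 hs0 hlaw

/-- **Signed form.** The note's law carries a sign `ε = ±1` (`λλ̄ = ε·N(r)·P·(t − t̄)^{2n}`, sign frame of
§3 there); for a Weil-ALIVE class (`λ ≠ 0`), `r ≠ 0`, `t ∉ ℚ` and `P = ∏ c_a > 0` positivity of the norm
forces `ε = +1`, and then `P ∈ N(ℚ(ω)^*)` as above. [folklore] -/
theorem gridLaw_signed_forces_eisensteinNorm (n : ℕ) {a b u v β P ε : ℚ} (hl : ¬ (a = 0 ∧ b = 0))
    (hr : ¬ (u = 0 ∧ v = 0)) (hβ : β ≠ 0) (hP : 0 < P) (hε : ε = 1 ∨ ε = -1)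
    (hlaw : a ^ 2 - a * b + b ^ 2 = ε * ((u ^ 2 - u * v + v ^ 2) * P * (3 * β ^ 2) ^ n)) :
    ε = 1 ∧ ∃ x y : ℚ, x ^ 2 - x * y + y ^ 2 = P := by
  have hNl : 0 < a ^ 2 - a * b + b ^ 2 :=
    lt_of_le_of_ne (eisensteinNorm_nonneg a b) (fun h => hl ((eisensteinNorm_eq_zero_iff a b).mp h.symm))
  have hNr : 0 < u ^ 2 - u * v + v ^ 2 :=
    lt_of_le_of_ne (eisensteinNorm_nonneg u v) (fun h => hr ((eisensteinNorm_eq_zero_iff u v).mp h.symm))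
  have hs : 0 < (3 * β ^ 2) ^ n := pow_pos (by positivity) n
  have hrhs : 0 < (u ^ 2 - u * v + v ^ 2) * P * (3 * β ^ 2) ^ n := by positivity
  rcases hε with rfl | rfl
  · rw [one_mul] at hlaw
    exact ⟨rfl, gridLaw_forces_eisensteinNorm n hr hβ hlaw⟩
  · exfalso
    rw [neg_mul, one_mul] at hlaw
    linarith

/-- **THEOREM GRID (iii) on the cell's deciding data, every `n`.** With `∏ c_a = 2` — the non-split
fourfold datum `(1,1,1,2)` (n = 2), the sixfold datum `R1 = (1,1,1,1,1,2)` (n = 3), the eightfold data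
`(1⁷,2)` (n = 4) — the grid law `N(λ) = N(r)·2·|t − t̄|^{2n}` has no solution with `r ≠ 0`, `t ∉ ℚ`:
no ⊠/secant-type object is class-exact and Weil-alive there (modulo the note's step (ii)).
[cite: IrelandRosen1990, Ch. 9 §1 Prop. 9.1.4] -/
theorem gridLaw_unsolvable_prodTwo (n : ℕ) (a b u v β : ℚ) (hr : ¬ (u = 0 ∧ v = 0)) (hβ : β ≠ 0) :
    a ^ 2 - a * b + b ^ 2 ≠ (u ^ 2 - u * v + v ^ 2) * 2 * (3 * β ^ 2) ^ n := by
  intro h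
  exact not_eisensteinNorm_two (gridLaw_forces_eisensteinNorm n hr hβ h)

/-- The same for every datum with `∏ c_a = 2m`, `m` a non-zero Eisenstein norm (e.g. `∏ c_a = 6, 8, 18`):
the law is unsolvable for every `n`. [cite: IrelandRosen1990, Ch. 9 §1 Prop. 9.1.4] -/
theorem gridLaw_unsolvable_prodTwoMulNorm (n : ℕ) (a b u v β m : ℚ)
    (hm : ∃ x y : ℚ, x ^ 2 - x * y + y ^ 2 = m)
    (hm0 : m ≠ 0) (hr : ¬ (u = 0 ∧ v = 0)) (hβ : β ≠ 0) :
    a ^ 2 - a * b + b ^ 2 ≠ (u ^ 2 - u * v + v ^ 2) * (2 * m) * (3 * β ^ 2) ^ n := by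
  intro h
  exact not_eisensteinNorm_two_mul hm hm0 (gridLaw_forces_eisensteinNorm n hr hβ h)

/-! ## The Gaussian twin `K = ℚ(i)`, `N(a + bi) = a² + b²`, `|t − t̄|² = 4β²` -/

/-- Gaussian norms `a² + b²` are the values of `x² + 1·y²`. [folklore] -/
theorem gaussNorm_iff_binNorm_one (m : ℚ) :
    (∃ a b : ℚ, a ^ 2 + b ^ 2 = m) ↔ ∃ x y : ℚ, x ^ 2 + 1 * y ^ 2 = m := by
  constructor
  · rintro ⟨a, b, rfl⟩; exact ⟨a, b, by ring⟩
  · rintro ⟨x, y, rfl⟩; exact ⟨x, y, by ring⟩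

/-- Descent step at the prime `3`, inert in `ℤ[i]`: `a² + b² = 3q²` over `ℤ` forces `3 ∣ a`, `3 ∣ b`,
`3 ∣ q` (squares are `0` or `1` mod `3`). [cite: IrelandRosen1990, Ch. 9 §1 Prop. 9.1.4] -/
theorem gaussNorm_three_descent {a b q : ℤ} (h : a ^ 2 + b ^ 2 = 3 * q ^ 2) :
    3 ∣ a ∧ 3 ∣ b ∧ 3 ∣ q := by
  -- squares mod 3 are 0 or 1, so x² + y² ≡ 0 (mod 3) forces x ≡ y ≡ 0
  have key : ∀ x y : ZMod 3, x ^ 2 + y ^ 2 = 0 → x = 0 ∧ y = 0 := by decide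
  have hcast : ((a : ZMod 3)) ^ 2 + ((b : ZMod 3)) ^ 2 = 0 := by
    have hc := congrArg (fun z : ℤ => (z : ZMod 3)) h
    push_cast at hc
    have h3 : (3 : ZMod 3) = 0 := by decide
    rw [hc, h3, zero_mul]
  obtain ⟨ha0, hb0⟩ := key _ _ hcast
  have ha : (3 : ℤ) ∣ a := (ZMod.intCast_zmod_eq_zero_iff_dvd a 3).mp ha0
  have hb : (3 : ℤ) ∣ b := (ZMod.intCast_zmod_eq_zero_iff_dvd b 3).mp hb0
  obtain ⟨a', rfl⟩ := ha
  obtain ⟨b', rfl⟩ := hb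
  have hq2 : q ^ 2 = 3 * (a' ^ 2 + b' ^ 2) := by linarith
  have hq : 3 ∣ q := by
    have : (3 : ℤ) ∣ q ^ 2 := ⟨a' ^ 2 + b' ^ 2, hq2⟩
    exact Int.Prime.dvd_pow' (by norm_num) this
  exact ⟨⟨a', rfl⟩, ⟨b', rfl⟩, hq⟩

/-- `a² + b² = 3q²` has only the trivial integral solution (`3` inert in `ℤ[i]`, infinite descent).
[cite: IrelandRosen1990, Ch. 9 §1 Prop. 9.1.4] -/
theorem gaussNorm_ne_three_mul_sq (a b q : ℤ) (h : a ^ 2 + b ^ 2 = 3 * q ^ 2) :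
    a = 0 ∧ b = 0 ∧ q = 0 := by
  suffices H : ∀ n : ℕ, ∀ a b q : ℤ, a.natAbs + b.natAbs + q.natAbs = n →
      a ^ 2 + b ^ 2 = 3 * q ^ 2 → a = 0 ∧ b = 0 ∧ q = 0 from H _ a b q rfl h
  intro n
  induction n using Nat.strong_induction_on with
  | _ n ih =>
    intro a b q hn hab
    by_cases hzero : a = 0 ∧ b = 0 ∧ q = 0
    · exact hzero
    · exfalso
      obtain ⟨⟨a', rfl⟩, ⟨b', rfl⟩, ⟨q', rfl⟩⟩ := gaussNorm_three_descent hab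
      have hab' : a' ^ 2 + b' ^ 2 = 3 * q' ^ 2 := by linarith
      have hlt : a'.natAbs + b'.natAbs + q'.natAbs < n := by
        have hne : ¬ (a' = 0 ∧ b' = 0 ∧ q' = 0) := by
          rintro ⟨rfl, rfl, rfl⟩; exact hzero ⟨by simp, by simp, by simp⟩
        rw [← hn, Int.natAbs_mul, Int.natAbs_mul, Int.natAbs_mul]
        simp only [Int.reduceAbs]
        omega
      obtain ⟨rfl, rfl, rfl⟩ := ih _ hlt a' b' q' rfl hab'
      exact hzero ⟨by simp, by simp, by simp⟩

/-- `x² + y² = 3r²` over `ℚ` forces `x = y = r = 0`: `3` is not a norm from `ℚ(i)`, not even up to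
squares. [cite: IrelandRosen1990, Ch. 9 §1 Prop. 9.1.4] -/
theorem gaussNorm_ne_three_mul_sq_rat (x y r : ℚ) (h : x ^ 2 + y ^ 2 = 3 * r ^ 2) :
    x = 0 ∧ y = 0 ∧ r = 0 := by
  set d : ℤ := (x.den : ℤ) * y.den * r.den with hd
  have hdpos : (0 : ℚ) < d := by
    have : 0 < d := by
      have h1 := x.den_pos; have h2 := y.den_pos; have h3 := r.den_pos
      positivity
    exact_mod_cast this
  have hd0 : (d : ℚ) ≠ 0 := ne_of_gt hdpos
  have hx : x * d = (x.num * y.den * r.den : ℤ) := by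
    have := Rat.mul_den_eq_num x
    push_cast [hd]
    calc x * ((x.den : ℚ) * y.den * r.den) = (x * x.den) * y.den * r.den := by ring
      _ = x.num * y.den * r.den := by rw [this]
  have hy : y * d = (y.num * x.den * r.den : ℤ) := by
    have := Rat.mul_den_eq_num y
    push_cast [hd]
    calc y * ((x.den : ℚ) * y.den * r.den) = (y * y.den) * x.den * r.den := by ring
      _ = y.num * x.den * r.den := by rw [this]
  have hr : r * d = (r.num * x.den * y.den : ℤ) := by
    have := Rat.mul_den_eq_num r
    push_cast [hd]
    calc r * ((x.den : ℚ) * y.den * r.den) = (r * r.den) * x.den * y.den := by ring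
      _ = r.num * x.den * y.den := by rw [this]
  set A : ℤ := x.num * y.den * r.den
  set B : ℤ := y.num * x.den * r.den
  set Q : ℤ := r.num * x.den * y.den
  have hABQ : ((A : ℚ)) ^ 2 + (B : ℚ) ^ 2 = 3 * (Q : ℚ) ^ 2 := by
    rw [← hx, ← hy, ← hr]
    have : (x * d) ^ 2 + (y * d) ^ 2 = (x ^ 2 + y ^ 2) * d ^ 2 := by ring
    rw [this, h]; ring
  have hint : A ^ 2 + B ^ 2 = 3 * Q ^ 2 := by exact_mod_cast hABQ
  obtain ⟨hA, hB, hQ⟩ := gaussNorm_ne_three_mul_sq A B Q hint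
  refine ⟨?_, ?_, ?_⟩
  · have : x * d = 0 := by rw [hx, hA]; simp
    rcases mul_eq_zero.mp this with h0 | h0
    · exact h0
    · exact absurd h0 hd0
  · have : y * d = 0 := by rw [hy, hB]; simp
    rcases mul_eq_zero.mp this with h0 | h0
    · exact h0
    · exact absurd h0 hd0
  · have : r * d = 0 := by rw [hr, hQ]; simp
    rcases mul_eq_zero.mp this with h0 | h0
    · exact h0
    · exact absurd h0 hd0

/-- `3` is not a Gaussian norm. [cite: IrelandRosen1990, Ch. 9 §1 Prop. 9.1.4] -/
theorem not_gaussNorm_three : ¬ ∃ a b : ℚ, a ^ 2 + b ^ 2 = 3 := by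
  rintro ⟨a, b, hab⟩
  have := gaussNorm_ne_three_mul_sq_rat a b 1 (by rw [hab]; ring)
  exact one_ne_zero this.2.2

/-- **THEOREM GRID, (ii) ⇒ (iii), `K = ℚ(i)`, every `n`.** If `λ = a + bi`, `r = u + vi ≠ 0`,
`t − t̄ = 2βi` (`β ≠ 0`) and `N(λ) = N(r) · P · |t − t̄|^{2n}` then `P ∈ N(ℚ(i)^*)`.
([Deligne1982HodgeCycles, §4 Cor. 4.2]; arithmetic only.) [folklore] -/
theorem gridLaw_forces_gaussNorm (n : ℕ) {a b u v β P : ℚ} (hr : ¬ (u = 0 ∧ v = 0)) (hβ : β ≠ 0)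
    (hlaw : a ^ 2 + b ^ 2 = (u ^ 2 + v ^ 2) * P * (4 * β ^ 2) ^ n) : ∃ x y : ℚ, x ^ 2 + y ^ 2 = P := by
  rw [gaussNorm_iff_binNorm_one]
  have hl : ∃ x y : ℚ, x ^ 2 + 1 * y ^ 2 = a ^ 2 + b ^ 2 := ⟨a, b, by ring⟩
  have hrN : ∃ x y : ℚ, x ^ 2 + 1 * y ^ 2 = u ^ 2 + v ^ 2 := ⟨u, v, by ring⟩
  have hs : ∃ x y : ℚ, x ^ 2 + 1 * y ^ 2 = (4 * β ^ 2) ^ n := by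
    have : (4 * β ^ 2 : ℚ) = (2 * β) ^ 2 := by ring
    rw [this]
    exact binNorm_pow (binNorm_sq 1 (2 * β)) n
  have hr0 : u ^ 2 + v ^ 2 ≠ 0 := by
    intro h
    have hu : u ^ 2 = 0 := by nlinarith [sq_nonneg u, sq_nonneg v]
    have hv : v ^ 2 = 0 := by nlinarith [sq_nonneg u, sq_nonneg v]
    exact hr ⟨pow_eq_zero_iff two_ne_zero |>.mp hu, pow_eq_zero_iff two_ne_zero |>.mp hv⟩
  have hs0 : (4 * β ^ 2) ^ n ≠ 0 := pow_ne_zero _ (by positivity)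
  exact binNorm_of_law hl hrN hs hr0 hs0 hlaw

/-- **THEOREM GRID (iii), Gaussian data with `∏ c_a = 3`** (non-split for `K = ℚ(i)`): the law is
unsolvable for every `n`. [cite: IrelandRosen1990, Ch. 9 §1 Prop. 9.1.4] -/
theorem gridLaw_gauss_unsolvable_prodThree (n : ℕ) (a b u v β : ℚ) (hr : ¬ (u = 0 ∧ v = 0))
    (hβ : β ≠ 0) : a ^ 2 + b ^ 2 ≠ (u ^ 2 + v ^ 2) * 3 * (4 * β ^ 2) ^ n := by
  intro h
  exact not_gaussNorm_three (gridLaw_forces_gaussNorm n hr hβ h)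

end Summit.Ventures.HSemireg
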